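import Summits.ResolutionOfSingularities.ResolutionOfSingularities.Theorems.WeightedInvariantContactCylinderValue
import HarnessLib

/-!
# MAXIMISER DESCENT at a special point of a permissible equimultiple curve — the lemmas (ORDER (o28), regime P3a,
# obligation (P3a-desc) of res-L1-w43-plan-1's IOTA3-DESIGN v1 §3)
# (door `HypersurfaceCentreConstruction`, stmt-ResolutionOfSingularities-19897; KEY `stub_localWeightedDropEFT4S`)

Topic: `Summits/ResolutionOfSingularities/ResolutionOfSingularities/Theorems`. Helper for the door item
`HypersurfaceCentreConstruction` (stmt-ResolutionOfSingularities-19897, route `WeightedInvariant`), line `local-engine` of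
res-L1-w43-plan-1 (L W4.3), ORDER (o28) (lead res-type-005, co-hand res-D-brk-1).  IOTA3-DESIGN v1 §3 P3a names the
obligation: «if ε(𝔪) = 0 and dim S⧸P = 1 then the P2 presentation of `J₂(S_P, f)` is realised by a regular system of
parameters of S at 𝔪 (parameters of S generating P, same weights)» — the VALUE file p522408 and the (open″) body p528319
ASSUME a pair `(x, g) ⊆ S` of regular parameters generating `P` with `g/1` a maximiser in `S_P`; the sibling file
`…ContactCylinderDescent` PROVES such a pair exists at every P3a position.  This file holds the ring-theoretic lemmas.

THE ARGUMENT (induction on the contact level `c`).  `R = S_P`, `𝔪_R = (ξ, η)` the images of the current pair `(x, g_c)`.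
A parameter `γ` reaching level `c + 1 ≥ 3` also reaches `c`, so by res-type-078's canonicity key step it is `w η + m` with
`m ∈ 𝔪_R^c = ξ^c R + η 𝔪_R^{c-1}` (`pow_span_pair_le`), i.e. `γ = w' (η + μ ξ^c)` with `w'` a unit.  INTEGRALITY of `μ`:
the contracted level `(x, g_c; 1, c)_{cν} ∋ f` unrolls to `f = Σ_{j ≤ ν} σ_j x^{c(ν-j)} g_c^j` (`exists_sum_eq_of_mem_weightedMonomialIdeal_pair`)
with `σ_ν` a UNIT by equimultiplicity (`not_mem_of_sum_eq_of_not_mem_pow`); substituting `η = γ' − μ ξ^c` gives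
`f ≡ ξ^{cν} · Q(μ) mod (γ')`, `Q(T) = Σ σ_j (−T)^j` (`sum_sub_pow_mul_sum_mem_span_singleton`), while level `c + 1` forces
`f ∈ (γ') + (ξ^{(c+1)ν})` (`weightedMonomialIdeal_le_span_singleton_sup_span_pow`); `R/(γ')` is a domain and `ξ ∉ (γ')`, so
`Q(μ) ∈ 𝔪_R` (`mem_sup_span_singleton_of_pow_mul_mem`); finally `S/P` is a VALUATION RING of `κ(P)`, so `μ = m/s` has
`s̄ ∣ m̄` — `μ ≡ a/1` — or `m̄ · c̄ = s̄` with `c ∈ 𝔪_S`, and then `c^ν Q(μ) ≡ ±σ_ν mod 𝔪_S` would be a unit inside `P`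
(`exists_sub_algebraMap_mem_of_sum_mem`).  The new pair `(x, g_c + a x^c)` has the same span, is again independent, and
reaches level `c + 1` (`weightedMonomialIdeal_pair_add_mul_pow_eq`).

[OURS · L1 W4.3 · (o28) P3a]  Replaces the role of NO printed item; NOT a statement of the manuscript
[claim: Hironaka2017, status: under-review]. AI work, weaker than expert review.  Pure commutative algebra; no named facts.

## References

* H. Matsumura, *Commutative Ring Theory* (1987), Thm. 11.2, 14.2, 14.3. [Matsumura1987]
* V. Cossart, U. Jannsen, S. Saito, LNM 2270 (2020), Ch. 8 (maximal contact in dimension two). [CossartJannsenSaito2020]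
* res-L1-w43-plan-1, `L/res-L1-w43-plan-1/IOTA3-DESIGN.md` v1 §3 P3a (OURS, AI planning).
-/

noncomputable section

open IsLocalRing Literature.AlgebraicGeometry.Resolution
open Summit.ResolutionOfSingularities.ResolutionOfSingularities.Cruxes.HypersurfaceCentreConstruction.LocalEngine

set_option linter.dupNamespace false -- mandated namespace of this single-conjunct summit

namespace Summit.ResolutionOfSingularities.ResolutionOfSingularities.Theorems

namespace ContactCylinder

namespace Descent

/-! ## Unrolling the contracted level `(x, g; 1, c)_{cν}` -/

/-- `(x, g; 1, c)_{c(ν+1)} ⊆ (g^{ν+1}) + x^c · (x, g; 1, c)_{cν}`: a monomial `x^a g^e` of weight `a + c e ≥ c(ν+1)` has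
`e ≥ ν + 1` or `a ≥ c`. [folklore] -/
theorem weightedMonomialIdeal_pair_succ_le {A : Type} [CommRing A] (x g : A) (c ν : ℕ) :
    weightedMonomialIdeal ![x, g] ![1, c] (c * (ν + 1)) ≤
      Ideal.span {g ^ (ν + 1)} ⊔ Ideal.span {x ^ c} * weightedMonomialIdeal ![x, g] ![1, c] (c * ν) := by
  rw [weightedMonomialIdeal, Ideal.span_le]
  rintro _ ⟨α, hα, rfl⟩
  simp only [Fin.sum_univ_two, Matrix.cons_val_zero, Matrix.cons_val_one, one_mul] at hα
  rw [Fin.prod_univ_two]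
  simp only [Matrix.cons_val_zero, Matrix.cons_val_one, SetLike.mem_coe]
  by_cases he : ν + 1 ≤ α 1
  · apply Ideal.mem_sup_left
    exact Ideal.mul_mem_left _ _ (Ideal.mem_span_singleton.mpr (pow_dvd_pow g he))
  · apply Ideal.mem_sup_right
    have hα1 : α 1 ≤ ν := by omega
    have ha : c ≤ α 0 := by
      have : c * α 1 ≤ c * ν := Nat.mul_le_mul_left c hα1
      have h2 : c * (ν + 1) = c * ν + c := by ring
      omega
    obtain ⟨d, hd⟩ := Nat.exists_eq_add_of_le ha
    rw [hd, pow_add, mul_assoc]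
    refine Ideal.mul_mem_mul (Ideal.mem_span_singleton_self _) ?_
    have h := prod_pow_mem_weightedMonomialIdeal ![x, g] ![1, c] (n := c * ν) ![d, α 1] (by
      simp only [Fin.sum_univ_two, Matrix.cons_val_zero, Matrix.cons_val_one, one_mul]
      have h2 : c * (ν + 1) = c * ν + c := by ring
      omega)
    simpa [Fin.prod_univ_two] using h

/-- **Unrolling**: `f ∈ (x, g; 1, c)_{cν}` is `f = Σ_{j ≤ ν} σ_j x^{c(ν − j)} g^j` with coefficients `σ_j` in the ring (any `c`;
for `c = 0` the statement is about `(g)`-multiples and still holds). [folklore] -/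
theorem exists_sum_eq_of_mem_weightedMonomialIdeal_pair {A : Type} [CommRing A] (x g : A) (c ν : ℕ)
    {f : A} (hf : f ∈ weightedMonomialIdeal ![x, g] ![1, c] (c * ν)) :
    ∃ σ : ℕ → A, f = ∑ j ∈ Finset.range (ν + 1), σ j * x ^ (c * (ν - j)) * g ^ j := by
  induction ν generalizing f with
  | zero => exact ⟨fun _ => f, by simp⟩
  | succ ν ih =>
    obtain ⟨a, ha, b, hb, hab⟩ := Submodule.mem_sup.mp (weightedMonomialIdeal_pair_succ_le x g c ν hf)
    obtain ⟨s, rfl⟩ := Ideal.mem_span_singleton'.mp ha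
    obtain ⟨ρ, hρ, rfl⟩ := Ideal.mem_span_singleton_mul.mp hb
    obtain ⟨σ', hσ'⟩ := ih hρ
    refine ⟨Function.update σ' (ν + 1) s, ?_⟩
    rw [Finset.sum_range_succ, Function.update_self, Nat.sub_self, mul_zero, pow_zero, mul_one, ← hab, add_comm, hσ',
      Finset.mul_sum]
    congr 1
    refine Finset.sum_congr rfl fun j hj => ?_
    have hjν : j ≤ ν := Nat.lt_succ_iff.mp (Finset.mem_range.mp hj)
    rw [Function.update_of_ne (by omega)]
    have hexp : c * (ν + 1 - j) = c + c * (ν - j) := by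
      rw [Nat.succ_sub hjν, Nat.mul_succ, Nat.add_comm]
    rw [hexp, pow_add]
    ring

/-- **Equimultiplicity makes the top coefficient a unit**: in a local ring with `x, g ∈ 𝔪` and `c ≥ 2`, if
`f = Σ_{j ≤ ν} σ_j x^{c(ν−j)} g^j ∉ 𝔪^{ν+1}` then `σ_ν ∉ 𝔪` (every other term has ordinary degree `≥ ν + 1`). [folklore] -/
theorem not_mem_of_sum_eq_of_not_mem_pow {A : Type} [CommRing A] [IsLocalRing A] {x g : A} (hx : x ∈ maximalIdeal A)
    (hg : g ∈ maximalIdeal A) {c : ℕ} (hc : 2 ≤ c) (ν : ℕ) (σ : ℕ → A) {f : A}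
    (hf : f = ∑ j ∈ Finset.range (ν + 1), σ j * x ^ (c * (ν - j)) * g ^ j) (hford : f ∉ maximalIdeal A ^ (ν + 1)) :
    σ ν ∉ maximalIdeal A := by
  intro hσ
  apply hford
  rw [hf, Finset.sum_range_succ]
  refine Ideal.add_mem _ (Ideal.sum_mem _ fun j hj => ?_) ?_
  · have hjν : j < ν := Finset.mem_range.mp hj
    have hdeg : ν + 1 ≤ c * (ν - j) + j := by
      have : 2 * (ν - j) ≤ c * (ν - j) := Nat.mul_le_mul_right _ hc
      omega
    rw [mul_assoc]
    refine Ideal.mul_mem_left _ _ (Ideal.pow_le_pow_right hdeg ?_)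
    rw [pow_add]
    exact Ideal.mul_mem_mul (Ideal.pow_mem_pow hx _) (Ideal.pow_mem_pow hg _)
  · rw [Nat.sub_self, mul_zero, pow_zero, mul_one, pow_succ']
    exact Ideal.mul_mem_mul hσ (Ideal.pow_mem_pow hg _)

/-! ## The face identity and the two inclusions in `R` -/

/-- **The face identity**: with `η = γ − μ ξ^c`, `Σ_{j ≤ ν} σ_j ξ^{c(ν−j)} η^j ≡ ξ^{cν} · Σ_{j ≤ ν} σ_j (−μ)^j (mod γ)`. [folklore] -/
theorem sum_sub_pow_mul_sum_mem_span_singleton {A : Type} [CommRing A] (ξ γ μ : A) (c ν : ℕ) (σ : ℕ → A) :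
    (∑ j ∈ Finset.range (ν + 1), σ j * ξ ^ (c * (ν - j)) * (γ - μ * ξ ^ c) ^ j) -
      ξ ^ (c * ν) * ∑ j ∈ Finset.range (ν + 1), σ j * (-μ) ^ j ∈ Ideal.span {γ} := by
  rw [Finset.mul_sum, ← Finset.sum_sub_distrib]
  refine Ideal.sum_mem _ fun j hj => ?_
  have hjν : j ≤ ν := Nat.lt_succ_iff.mp (Finset.mem_range.mp hj)
  have hξ : ξ ^ (c * ν) = ξ ^ (c * (ν - j)) * ξ ^ (c * j) := by
    rw [← pow_add, ← Nat.mul_add, Nat.sub_add_cancel hjν]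
  have hrw : ξ ^ (c * ν) * (σ j * (-μ) ^ j) = σ j * ξ ^ (c * (ν - j)) * (-μ * ξ ^ c) ^ j := by
    rw [hξ, mul_pow, ← pow_mul, mul_comm c j]
    ring
  rw [hrw, ← mul_sub]
  refine Ideal.mul_mem_left _ _ (Ideal.mem_span_singleton.mpr ?_)
  have h := (Commute.all (γ - μ * ξ ^ c) (-μ * ξ ^ c)).sub_dvd_pow_sub_pow j
  rwa [show γ - μ * ξ ^ c - -μ * ξ ^ c = γ by ring] at h

/-- `(ξ, γ; 1, b)_{bν} ⊆ (γ) + (ξ^{bν})`: a monomial `ξ^a γ^e` of weight `a + b e ≥ b ν` is a multiple of `γ` or has `a ≥ bν`.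
[folklore] -/
theorem weightedMonomialIdeal_le_span_singleton_sup_span_pow {A : Type} [CommRing A] (ξ γ : A) (b ν : ℕ) :
    weightedMonomialIdeal ![ξ, γ] ![1, b] (b * ν) ≤ Ideal.span {γ} ⊔ Ideal.span {ξ ^ (b * ν)} := by
  rw [weightedMonomialIdeal, Ideal.span_le]
  rintro _ ⟨α, hα, rfl⟩
  simp only [Fin.sum_univ_two, Matrix.cons_val_zero, Matrix.cons_val_one, one_mul] at hα
  rw [Fin.prod_univ_two]
  simp only [Matrix.cons_val_zero, Matrix.cons_val_one, SetLike.mem_coe]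
  rcases Nat.eq_zero_or_pos (α 1) with h0 | hpos
  · rw [h0, pow_zero, mul_one]
    rw [h0, mul_zero, add_zero] at hα
    apply Ideal.mem_sup_right
    obtain ⟨d, hd⟩ := Nat.exists_eq_add_of_le hα
    rw [hd, pow_add]
    exact Ideal.mul_mem_right _ _ (Ideal.mem_span_singleton_self _)
  · apply Ideal.mem_sup_left
    obtain ⟨d, hd⟩ := Nat.exists_eq_add_of_le (Nat.one_le_iff_ne_zero.mpr hpos.ne')
    rw [hd, pow_add, pow_one]
    exact Ideal.mul_mem_left _ _ (Ideal.mul_mem_right _ _ (Ideal.mem_span_singleton_self _))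

/-- **Cancellation along `(γ)`**: if `(γ)` is prime, `ξ ∉ (γ)` and `ξ^n · q ∈ (γ) + (ξ^{n+1})`, then `q ∈ (γ) + (ξ)`. [folklore] -/
theorem mem_sup_span_singleton_of_pow_mul_mem {A : Type} [CommRing A] {ξ γ : A} (hγ : (Ideal.span {γ}).IsPrime)
    (hξ : ξ ∉ Ideal.span {γ}) (n : ℕ) {q : A} (h : ξ ^ n * q ∈ Ideal.span {γ} ⊔ Ideal.span {ξ ^ (n + 1)}) :
    q ∈ Ideal.span {γ} ⊔ Ideal.span {ξ} := by
  obtain ⟨a, ha, b, hb, hab⟩ := Submodule.mem_sup.mp h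
  obtain ⟨r, rfl⟩ := Ideal.mem_span_singleton'.mp hb
  -- `ξ^n (q − r ξ) = a ∈ (γ)`
  have hmem : ξ ^ n * (q - r * ξ) ∈ Ideal.span {γ} := by
    have : ξ ^ n * (q - r * ξ) = a := by
      rw [mul_sub, ← hab]
      ring
    rw [this]
    exact ha
  rcases hγ.mem_or_mem hmem with h1 | h2
  · exact absurd (hγ.mem_of_pow_mem n h1) hξ
  · have hq : q = (q - r * ξ) + r * ξ := by ring
    rw [hq]
    exact Ideal.add_mem _ (Ideal.mem_sup_left h2) (Ideal.mem_sup_right (Ideal.mul_mem_left _ _ (Ideal.mem_span_singleton_self _)))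

/-- `(ξ, η)^c ⊆ (ξ^c) + η · (ξ, η)^{c−1}` for `c ≥ 1`. [folklore] -/
theorem pow_span_pair_le {A : Type} [CommRing A] (ξ η : A) (c : ℕ) :
    Ideal.span {ξ, η} ^ (c + 1) ≤ Ideal.span {ξ ^ (c + 1)} ⊔ Ideal.span {η} * Ideal.span {ξ, η} ^ c := by
  induction c with
  | zero =>
    rw [zero_add, pow_one, pow_zero, mul_one, pow_one, Ideal.span_insert]
  | succ c ih =>
    rw [pow_succ]
    refine le_trans (Ideal.mul_mono_left ih) ?_
    rw [Ideal.sup_mul]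
    refine sup_le ?_ ?_
    · -- `(ξ^{c+1}) · (ξ, η) ⊆ (ξ^{c+2}) + (η) (ξ, η)^{c+1}`
      rw [Ideal.mul_le]
      intro a ha b hb
      obtain ⟨r, rfl⟩ := Ideal.mem_span_singleton'.mp ha
      obtain ⟨p, q, rfl⟩ := Ideal.mem_span_pair.mp hb
      have hsplit : r * ξ ^ (c + 1) * (p * ξ + q * η) = r * p * ξ ^ (c + 1 + 1) + η * (r * q * ξ ^ (c + 1)) := by ring
      rw [hsplit]
      refine Ideal.add_mem _ (Ideal.mem_sup_left (Ideal.mul_mem_left _ _ (Ideal.mem_span_singleton_self _)))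
        (Ideal.mem_sup_right (Ideal.mul_mem_mul (Ideal.mem_span_singleton_self _)
          (Ideal.mul_mem_left _ _ (Ideal.pow_mem_pow (Ideal.subset_span (by simp)) _))))
    · -- `(η) (ξ, η)^c · (ξ, η) = (η) (ξ, η)^{c+1}`
      rw [mul_assoc, ← pow_succ]
      exact le_sup_right

/-! ## Integrality through the valuation ring `S ⧸ P` -/

/-- **Integrality of `μ`.**  `S → R` the localisation at a prime `P ≤ 𝔪_S` of a local ring `S` with the VALUATION
DICHOTOMY for `S ⧸ P` (for `a, b ∈ S`, `b ∉ P`: `a ≡ b c` or `b ≡ a c` with `c ∈ 𝔪_S`, modulo `P`); `σ : ℕ → S` with `σ_ν` a unit;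
`μ ∈ R` with `Σ_{j ≤ ν} σ_j (−μ)^j ∈ 𝔪_R`.  Then `μ ≡ a/1 (mod 𝔪_R)` for some `a ∈ S`: otherwise `μ · c ≡ 1` with `c ∈ 𝔪_S` and
`c^ν · Σ σ_j (−μ)^j ≡ Σ σ_j (−1)^j c^{ν−j} ≡ ±σ_ν (mod 𝔪_S)` would be a unit of `S` inside `𝔪_R ∩ S = P`.
[cite: Matsumura1987, Thm. 11.2] -/
theorem exists_sub_algebraMap_mem_of_sum_mem {S : Type} [CommRing S] [IsLocalRing S] (P : Ideal S) [P.IsPrime]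
    (hval : ∀ a b : S, b ∉ P → ∃ c : S, a - b * c ∈ P ∨ (c ∈ maximalIdeal S ∧ b - a * c ∈ P))
    {ν : ℕ} (σ : ℕ → S) (hσ : σ ν ∉ maximalIdeal S) (μ : Localization.AtPrime P)
    (hQ : (∑ j ∈ Finset.range (ν + 1), algebraMap S (Localization.AtPrime P) (σ j) * (-μ) ^ j) ∈
      maximalIdeal (Localization.AtPrime P)) :
    ∃ a : S, μ - algebraMap S (Localization.AtPrime P) a ∈ maximalIdeal (Localization.AtPrime P) := by
  obtain ⟨⟨m, s⟩, hms⟩ := IsLocalization.surj P.primeCompl μ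
  -- `μ · s/1 = m/1`
  have hs : (s : S) ∉ P := s.2
  have hsu : IsUnit (algebraMap S (Localization.AtPrime P) (s : S)) :=
    IsLocalization.map_units (Localization.AtPrime P) s
  have hmaxP : ∀ a : S, algebraMap S (Localization.AtPrime P) a ∈ maximalIdeal (Localization.AtPrime P) ↔ a ∈ P :=
    fun a => IsLocalization.AtPrime.to_map_mem_maximal_iff (Localization.AtPrime P) P a
  obtain ⟨c, hc | ⟨hc𝔪, hc⟩⟩ := hval m s hs
  · -- `m ≡ s c`: `μ ≡ c`
    refine ⟨c, ?_⟩
    have h1 : (μ - algebraMap S _ c) * algebraMap S (Localization.AtPrime P) (s : S) =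
        algebraMap S (Localization.AtPrime P) (m - s * c) := by
      rw [sub_mul, hms, map_sub, map_mul]
      ring
    have h2 : (μ - algebraMap S _ c) * algebraMap S (Localization.AtPrime P) (s : S) ∈
        maximalIdeal (Localization.AtPrime P) := by
      rw [h1]
      exact (hmaxP _).mpr hc
    exact ((Ideal.IsPrime.mul_mem_iff_mem_or_mem inferInstance).mp h2).resolve_right
      (fun h => (hmaxP s).mp h |> hs)
  · -- `s ≡ m c` with `c ∈ 𝔪_S`: `μ c ≡ 1`, contradiction
    exfalso
    set φ := algebraMap S (Localization.AtPrime P) with hφ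
    have hμc : μ * φ c - 1 ∈ maximalIdeal (Localization.AtPrime P) := by
      have h1 : (μ * φ c - 1) * φ (s : S) = -φ (s - m * c) := by
        rw [sub_mul, mul_assoc, mul_comm (φ c), ← mul_assoc, hms, map_sub, map_mul]
        ring
      have h2 : (μ * φ c - 1) * φ (s : S) ∈ maximalIdeal (Localization.AtPrime P) := by
        rw [h1]
        exact neg_mem ((hmaxP _).mpr hc)
      exact ((Ideal.IsPrime.mul_mem_iff_mem_or_mem inferInstance).mp h2).resolve_right
        (fun h => (hmaxP s).mp h |> hs)
    -- pass to the residue field of `R`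
    have hres : residue (Localization.AtPrime P) (μ * φ c) = 1 := by
      have := (residue_eq_zero_iff _).mpr hμc
      rwa [map_sub, map_one, sub_eq_zero] at this
    have hQ0 : residue (Localization.AtPrime P) (∑ j ∈ Finset.range (ν + 1), φ (σ j) * (-μ) ^ j) = 0 :=
      (residue_eq_zero_iff _).mpr hQ
    -- `τ = Σ σ_j (−1)^j c^{ν−j} ∈ S`
    set τ : S := ∑ j ∈ Finset.range (ν + 1), σ j * (-1) ^ j * c ^ (ν - j) with hτ
    have hres' : residue (Localization.AtPrime P) μ * residue (Localization.AtPrime P) (φ c) = 1 := by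
      rw [← map_mul, hres]
    have key : ∀ (a : ResidueField (Localization.AtPrime P)) (j : ℕ), j ≤ ν →
        residue (Localization.AtPrime P) (φ c) ^ ν * (a * (-residue (Localization.AtPrime P) μ) ^ j) =
          a * (-1) ^ j * residue (Localization.AtPrime P) (φ c) ^ (ν - j) := by
      intro a j hj
      have h1 : residue (Localization.AtPrime P) (φ c) ^ ν =
          residue (Localization.AtPrime P) (φ c) ^ (ν - j) * residue (Localization.AtPrime P) (φ c) ^ j := by
        rw [← pow_add, Nat.sub_add_cancel hj]
      have h2 : (residue (Localization.AtPrime P) μ * residue (Localization.AtPrime P) (φ c)) ^ j = 1 := by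
        rw [hres', one_pow]
      calc residue (Localization.AtPrime P) (φ c) ^ ν * (a * (-residue (Localization.AtPrime P) μ) ^ j)
          = a * (-1) ^ j * residue (Localization.AtPrime P) (φ c) ^ (ν - j) *
              (residue (Localization.AtPrime P) μ * residue (Localization.AtPrime P) (φ c)) ^ j := by
            rw [h1, neg_pow, mul_pow]; ring
        _ = a * (-1) ^ j * residue (Localization.AtPrime P) (φ c) ^ (ν - j) := by rw [h2, mul_one]
    have hτres : residue (Localization.AtPrime P) (φ τ) =
        residue (Localization.AtPrime P) (φ c) ^ ν *
          residue (Localization.AtPrime P) (∑ j ∈ Finset.range (ν + 1), φ (σ j) * (-μ) ^ j) := by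
      simp only [hτ, map_sum, map_mul, map_pow, map_neg, map_one, Finset.mul_sum]
      exact Finset.sum_congr rfl fun j hj => (key _ _ (Nat.lt_succ_iff.mp (Finset.mem_range.mp hj))).symm
    rw [hQ0, mul_zero, residue_eq_zero_iff, hmaxP] at hτres
    -- but `τ ≡ ± σ_ν (mod 𝔪_S)` is a unit
    have hτ𝔪 : τ - σ ν * (-1) ^ ν ∈ maximalIdeal S := by
      rw [hτ, Finset.sum_range_succ, Nat.sub_self, pow_zero, mul_one, add_sub_cancel_right]
      refine Ideal.sum_mem _ fun j hj => ?_
      have hjν : j < ν := Finset.mem_range.mp hj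
      obtain ⟨d, hd⟩ := Nat.exists_eq_add_of_le (Nat.one_le_iff_ne_zero.mpr (by omega : ν - j ≠ 0))
      rw [hd, pow_add, pow_one]
      exact Ideal.mul_mem_left _ _ (Ideal.mul_mem_right _ _ hc𝔪)
    have hP𝔪 : P ≤ maximalIdeal S := IsLocalRing.le_maximalIdeal (Ideal.IsPrime.ne_top ‹_›)
    have hunit : σ ν * (-1) ^ ν ∈ maximalIdeal S := by
      have := Ideal.sub_mem _ (hP𝔪 hτres) hτ𝔪
      rwa [sub_sub_cancel] at this
    exact hσ (((Ideal.IsPrime.mul_mem_iff_mem_or_mem inferInstance).mp hunit).resolve_right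
      (fun h => (IsLocalRing.mem_maximalIdeal _).mp h ((isUnit_one.neg).pow ν)))

/-! ## Replacing `μ` by an integral representative: same span, same independence, same filtration -/

/-- `(ξ, η + a ξ^c) = (ξ, η)` for `c ≥ 1`. [folklore] -/
theorem span_pair_add_mul_pow_eq {A : Type} [CommRing A] (ξ η a : A) {c : ℕ} (hc : 1 ≤ c) :
    Ideal.span {ξ, η + a * ξ ^ c} = Ideal.span {ξ, η} := by
  have h := LocalGameEFTSteepening.span_pair_steepen_eq ξ η (-a) hc
  rwa [neg_mul, sub_neg_eq_add] at h

/-- Independence of differentials survives `η ↦ η + a ξ^c` (`c ≥ 1`). [folklore] -/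
theorem linearIndependent_toCotangent_pair_add_mul_pow {A : Type} [CommRing A] [IsLocalRing A] {ξ η : A} (a : A)
    {c : ℕ} (hc : 1 ≤ c) (hmem : ∀ i, (![ξ, η] : Fin 2 → A) i ∈ maximalIdeal A)
    (hli : LinearIndependent (ResidueField A) (fun i => (maximalIdeal A).toCotangent ⟨(![ξ, η] : Fin 2 → A) i, hmem i⟩))
    (hmem' : ∀ i, (![ξ, η + a * ξ ^ c] : Fin 2 → A) i ∈ maximalIdeal A) :
    LinearIndependent (ResidueField A) (fun i => (maximalIdeal A).toCotangent
      ⟨(![ξ, η + a * ξ ^ c] : Fin 2 → A) i, hmem' i⟩) := by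
  rw [linearIndependent_toCotangent_iff_forall_mem] at hli ⊢
  intro r hr
  simp only [Fin.sum_univ_two, Matrix.cons_val_zero, Matrix.cons_val_one] at hr
  obtain ⟨d, hd⟩ := Nat.exists_eq_add_of_le hc
  have hr' : ∑ i, (![r 0 + r 1 * a * ξ ^ d, r 1] : Fin 2 → A) i * (![ξ, η] : Fin 2 → A) i ∈ maximalIdeal A ^ 2 := by
    simp only [Fin.sum_univ_two, Matrix.cons_val_zero, Matrix.cons_val_one]
    have : (r 0 + r 1 * a * ξ ^ d) * ξ + r 1 * η = r 0 * ξ + r 1 * (η + a * ξ ^ c) := by rw [hd]; ring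
    rw [this]
    exact hr
  have h := hli _ hr'
  have h1 : r 1 ∈ maximalIdeal A := by simpa using h 1
  have h0 : r 0 + r 1 * a * ξ ^ d ∈ maximalIdeal A := by simpa using h 0
  have h0' : r 0 ∈ maximalIdeal A := by
    have : r 0 = (r 0 + r 1 * a * ξ ^ d) - r 1 * a * ξ ^ d := by ring
    rw [this]
    exact Ideal.sub_mem _ h0 (Ideal.mul_mem_right _ _ (Ideal.mul_mem_right _ _ h1))
  exact Fin.forall_fin_two.2 ⟨h0', h1⟩

/-- **Same `(1, c+1)`-filtration for `η + μ ξ^c` and `η + a ξ^c` when `μ ≡ a (mod (ξ, η))`** (the difference `(a − μ) ξ^c` has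
weight `≥ c + 1` in either system; `weightedMonomialIdeal_eq_of_forall_sub_mem`). [folklore] -/
theorem weightedMonomialIdeal_pair_add_mul_pow_eq {A : Type} [CommRing A] (ξ η μ a : A) {c : ℕ} (hc : 1 ≤ c)
    (h : μ - a ∈ Ideal.span {ξ, η}) (n : ℕ) :
    weightedMonomialIdeal ![ξ, η + a * ξ ^ c] ![1, c + 1] n = weightedMonomialIdeal ![ξ, η + μ * ξ ^ c] ![1, c + 1] n := by
  -- `(b − b') ξ^c` has weight `≥ c + 1` in the system `(ξ, η + b' ξ^c)` whenever `b − b' ∈ (ξ, η)`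
  have key : ∀ b b' : A, b - b' ∈ Ideal.span {ξ, η} →
      (η + b * ξ ^ c) - (η + b' * ξ ^ c) ∈ weightedMonomialIdeal ![ξ, η + b' * ξ ^ c] ![1, c + 1] (c + 1) := by
    intro b b' hbb'
    rw [← span_pair_add_mul_pow_eq ξ η b' hc] at hbb'
    obtain ⟨p, q, hpq⟩ := Ideal.mem_span_pair.mp hbb'
    have hrw : (η + b * ξ ^ c) - (η + b' * ξ ^ c) = p * ξ ^ (c + 1) + q * ξ ^ c * (η + b' * ξ ^ c) := by
      rw [show (η + b * ξ ^ c) - (η + b' * ξ ^ c) = (b - b') * ξ ^ c by ring, ← hpq]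
      ring
    rw [hrw]
    refine Ideal.add_mem _ (Ideal.mul_mem_left _ _ (LocalGameEFTSteepening.fst_pow_mem ξ _ (c + 1) (c + 1)))
      (Ideal.mul_mem_left _ _ (LocalGameEFTSteepening.snd_mem ξ _ (c + 1)))
  refine weightedMonomialIdeal_eq_of_forall_sub_mem ![ξ, η + μ * ξ ^ c] ![ξ, η + a * ξ ^ c] ![1, c + 1]
    (Fin.forall_fin_two.2 ⟨by simp, ?_⟩) (Fin.forall_fin_two.2 ⟨by simp, ?_⟩) n
  · simpa using key a μ (by rw [← neg_sub]; exact neg_mem h)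
  · simpa using key μ a h

end Descent

end ContactCylinder

end Summit.ResolutionOfSingularities.ResolutionOfSingularities.Theorems

end
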